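import Literature.Geometry.Lorentzian.KIDJetRigidity
import Literature.Geometry.Lorentzian.ParametricAnnulusGluingKIDExhaustion
import HarnessLib

/-!
# `ChruscielDelay_parametricAnnulusGluing` reduced to the Chruściel–Delay theorem on a compact
# annulus: the KID hypotheses `(J)` and `(K)` discharged

Topic `Literature/Geometry/Lorentzian`. Everything here is PROVED; no definition, no statement of
`Prop` type is introduced (the compact-annulus theorem `(E)` is a HYPOTHESIS, spelled out in place,
exactly as in `ParametricAnnulusGluingCore.lean`).

`ParametricAnnulusGluingCore.lean` proves `(K) ∧ (E) ⟹ ChruscielDelay_parametricAnnulusGluing` and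
`ParametricAnnulusGluingKIDExhaustion.lean` proves `(J) ⟹ (K)`, where

* `(J)` is the **one-jet rigidity of Killing initial data** on connected open subsets of `E3`
  carrying smooth Riemannian coordinate vacuum data, and
* `(K)` the **KID exhaustion**: KID-free vacuum data on an open annulus are KID-free on some open
  sub-annulus.

Here `(J)` is PROVED (`kidJetRigidity`) from the chart-level unique-continuation theorem
`KIDJetRigidity.eqOn_zero_of_isPreconnected` (`KIDJetRigidity.lean`: the KID system is of finite
type — the braid identity for the inhomogeneous Killing equation `𝓛_Y G = -4N K` and the second KID
equation bound all second derivatives of `(N, Y)` by the one-jet — so a vanishing one-jet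
propagates along segments by Grönwall and to the whole connected set by an open–closed argument;
Moncrief 1975, §III; Beig–Chruściel 1997, §2), whence `(K)` (`kidExhaustion`) and the reduction of
the named fact to `(E)` alone (`ChruscielDelay_parametricAnnulusGluing_of_compactCore`). What remains
of `ChruscielDelay_parametricAnnulusGluing` after this file is exactly the analytic core `(E)`:
Chruściel–Delay 2003, Thm. 5.9 with Prop. 5.10 and Cor. 5.11 on a compact annulus, in parametric
form (2004, Thm. 6.6) — weighted-space elliptic theory not available in the tree.

* `kidJetRigidity` — `(J)`;
* `kidExhaustion` — `(K)`, the hypothesis of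
  `ChruscielDelay_parametricAnnulusGluing_of_kidExhaustion_of_compactCore`, verbatim;
* `ChruscielDelay_parametricAnnulusGluing_of_compactCore` — `(E) ⟹ ChruscielDelay_parametricAnnulusGluing`.

## References

* V. Moncrief, *Spacetime symmetries and linearization stability of the Einstein equations. I*,
  J. Math. Phys. 16 (1975) 493–498, §III. [Moncrief1975]
* R. Beig, P. T. Chruściel, *Killing initial data*, Class. Quantum Grav. 14 (1997) A83–A92, §2.
* P. T. Chruściel, E. Delay, Mém. Soc. Math. Fr. 94 (2003), Thm. 5.9, Prop. 5.10, Cor. 5.11,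
  §8.6. [ChruscielDelay2003]
* P. T. Chruściel, E. Delay, J. Geom. Phys. 51 (2004), Thm. 6.6. [ChruscielDelay2004]
-/

noncomputable section

set_option maxSynthPendingDepth 3

open Set Function Filter TopologicalSpace Module Metric
open scoped ContDiff Topology

namespace Literature.Geometry.Lorentzian

/-! ### `(J)`: one-jet rigidity of KIDs on connected open subsets of `E3` -/

/-- **One-jet rigidity of Killing initial data `(J)`.** On a connected open set `V ⊆ E3` carrying
smooth Riemannian coordinate vacuum data `(G, K)` (`H = 0`, `M = 0`), a smooth KID `(N, Y)` —
a solution on `V` of `DH*_γ N + DM*ˢ_γ Y = 0`, `DH*_κ N + DM*ˢ_κ Y = 0` — whose one-jet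
`(N, dN, Y, DY)` vanishes at one point of `V` vanishes on `V`
(`KIDJetRigidity.eqOn_zero_of_isPreconnected` for the metric `MetricCoord.isMetricOn_of_pos`,
`dim E3 = 3 ≠ 1`). Moncrief 1975, §III; Beig–Chruściel 1997, §2. [cite: Moncrief1975, §III] -/
theorem kidJetRigidity {ι : Type} [Fintype ι] (b₀ : Basis ι ℝ E3) :
    ∀ (V : Set E3), IsOpen V → IsConnected V →
      ∀ (G K : E3 → E3 →L[ℝ] E3 →L[ℝ] ℝ), ContDiffOn ℝ ∞ G V → ContDiffOn ℝ ∞ K V →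
        (∀ z ∈ V, ∀ v w : E3, G z v w = G z w v ∧ K z v w = K z w v) →
        (∀ z ∈ V, ∀ v : E3, v ≠ 0 → 0 < G z v v) →
        (∀ z ∈ V, MetricCoord.hamAt G K z = 0 ∧ ∀ Z : E3, MetricCoord.momFn b₀ G K z Z = 0) →
        ∀ (N : E3 → ℝ) (Y : E3 → E3), ContDiffOn ℝ ∞ N V → ContDiffOn ℝ ∞ Y V →
          (∀ z ∈ V, MetricCoord.adjHamG G K N z + MetricCoord.adjMomGS G K Y z = 0 ∧
            MetricCoord.adjHamK G K N z + MetricCoord.adjMomKS G Y z = 0) →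
          ∀ z₀ ∈ V, N z₀ = 0 → fderiv ℝ N z₀ = 0 → Y z₀ = 0 → fderiv ℝ Y z₀ = 0 →
            ∀ z ∈ V, N z = 0 ∧ Y z = 0 := by
  intro V hV hconn G K hGs hKs hsym hpos hvac N Y hN hY hkid z₀ hz₀ hN0 hN1 hY0 hY1 z hz
  have hG : MetricCoord.IsMetricOn G V :=
    MetricCoord.isMetricOn_of_pos hV hGs (fun y hy v w ↦ (hsym y hy v w).1) hpos
  have hn : finrank ℝ E3 ≠ 1 := by
    rw [finrank_euclideanSpace_fin]; norm_num
  have htwo : (2 : WithTop ℕ∞) ≤ ∞ := WithTop.coe_le_coe.2 le_top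
  have h := KIDJetRigidity.eqOn_zero_of_isPreconnected b₀ hG hconn.isPreconnected hn hKs
    (fun y hy v w ↦ (hsym y hy v w).2) (hN.of_le htwo) (hY.of_le htwo) hvac hkid hz₀ hN0 hN1
    hY0 hY1 z hz
  exact ⟨h.1, h.2.2.1⟩

/-! ### `(K)` and the reduction of the fact to `(E)` -/

/-- **KID exhaustion `(K)`**: smooth Riemannian coordinate vacuum data without KIDs on the open
annulus `{R₁ < ‖z‖ < R₂}` of `E3` (`0 < R₁`) have no KIDs on some open sub-annulus
`{a < ‖z‖ < b}`, `R₁ < a < b < R₂` — the hypothesis `(K)` of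
`ChruscielDelay_parametricAnnulusGluing_of_kidExhaustion_of_compactCore`, now unconditional
(`kidExhaustion_of_kidJetRigidity` with `(J) = kidJetRigidity`). Chruściel–Delay 2003, §8.6.
[cite: Moncrief1975, §III] [cite: ChruscielDelay2003, §8.6] -/
theorem kidExhaustion {ι : Type} [Fintype ι] (b₀ : Basis ι ℝ E3) :
    ∀ (R₁ R₂ : ℝ), 0 < R₁ → R₁ < R₂ →
      ∀ (G K : E3 → E3 →L[ℝ] E3 →L[ℝ] ℝ),
        ContDiffOn ℝ ∞ G {z : E3 | R₁ < ‖z‖ ∧ ‖z‖ < R₂} →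
        ContDiffOn ℝ ∞ K {z : E3 | R₁ < ‖z‖ ∧ ‖z‖ < R₂} →
        (∀ z : E3, R₁ < ‖z‖ → ‖z‖ < R₂ → ∀ v w : E3, G z v w = G z w v ∧ K z v w = K z w v) →
        (∀ z : E3, R₁ < ‖z‖ → ‖z‖ < R₂ → ∀ v : E3, v ≠ 0 → 0 < G z v v) →
        (∀ z : E3, R₁ < ‖z‖ → ‖z‖ < R₂ →
          MetricCoord.hamAt G K z = 0 ∧ ∀ Z : E3, MetricCoord.momFn b₀ G K z Z = 0) →
        (∀ (N : E3 → ℝ) (Y : E3 → E3),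
          ContDiffOn ℝ ∞ N {z : E3 | R₁ < ‖z‖ ∧ ‖z‖ < R₂} →
          ContDiffOn ℝ ∞ Y {z : E3 | R₁ < ‖z‖ ∧ ‖z‖ < R₂} →
          (∀ z : E3, R₁ < ‖z‖ → ‖z‖ < R₂ →
            MetricCoord.adjHamG G K N z + MetricCoord.adjMomGS G K Y z = 0 ∧
            MetricCoord.adjHamK G K N z + MetricCoord.adjMomKS G Y z = 0) →
          ∀ z : E3, R₁ < ‖z‖ → ‖z‖ < R₂ → N z = 0 ∧ Y z = 0) →
        ∃ a b : ℝ, R₁ < a ∧ a < b ∧ b < R₂ ∧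
          ∀ (N : E3 → ℝ) (Y : E3 → E3),
            ContDiffOn ℝ ∞ N {z : E3 | a < ‖z‖ ∧ ‖z‖ < b} →
            ContDiffOn ℝ ∞ Y {z : E3 | a < ‖z‖ ∧ ‖z‖ < b} →
            (∀ z : E3, a < ‖z‖ → ‖z‖ < b →
              MetricCoord.adjHamG G K N z + MetricCoord.adjMomGS G K Y z = 0 ∧
              MetricCoord.adjHamK G K N z + MetricCoord.adjMomKS G Y z = 0) →
            ∀ z : E3, a < ‖z‖ → ‖z‖ < b → N z = 0 ∧ Y z = 0 :=
  kidExhaustion_of_kidJetRigidity b₀ (kidJetRigidity b₀)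

/-- **`ChruscielDelay_parametricAnnulusGluing` from the Chruściel–Delay theorem on a compact annulus
`(E)` alone** (`(E)` spelled out: for a smooth family `(G c, K c)` of symmetric positive coordinate
data on `{R₁ < ‖z‖ < R₂}`, vacuum at `c = 0` and off the shell `{a' ≤ ‖z‖ ≤ b'}`, with `(G 0, K 0)`
KID-free on `{a < ‖z‖ < b}`, a smooth vacuum correction for small `c` supported in `[a, b]`;
Chruściel–Delay 2003, Thm. 5.9, Prop. 5.10, Cor. 5.11, §8.6; 2004, Thm. 6.6): the KID hypotheses
of the earlier reductions are discharged by `kidJetRigidity` / `kidExhaustion`. `(E)` is NOT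
proved in the tree. [cite: ChruscielDelay2003, Thm. 5.9, Prop. 5.10, Cor. 5.11 and §8.6] -/
theorem ChruscielDelay_parametricAnnulusGluing_of_compactCore {ι : Type} [Fintype ι]
    (b₀ : Basis ι ℝ E3)
    (hE : ∀ (R₁ a a' b' b R₂ : ℝ), 0 < R₁ → R₁ < a → a < a' → a' < b' → b' < b → b < R₂ →
      ∀ (G K : EuclideanSpace ℝ (Fin 1) → E3 → E3 →L[ℝ] E3 →L[ℝ] ℝ),
        ContDiffOn ℝ ∞ (fun p : EuclideanSpace ℝ (Fin 1) × E3 ↦ G p.1 p.2)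
          ((univ : Set (EuclideanSpace ℝ (Fin 1))) ×ˢ {z : E3 | R₁ < ‖z‖ ∧ ‖z‖ < R₂}) →
        ContDiffOn ℝ ∞ (fun p : EuclideanSpace ℝ (Fin 1) × E3 ↦ K p.1 p.2)
          ((univ : Set (EuclideanSpace ℝ (Fin 1))) ×ˢ {z : E3 | R₁ < ‖z‖ ∧ ‖z‖ < R₂}) →
        (∀ c, ∀ z : E3, R₁ < ‖z‖ → ‖z‖ < R₂ → ∀ v w : E3,
          G c z v w = G c z w v ∧ K c z v w = K c z w v) →
        (∀ c, ∀ z : E3, R₁ < ‖z‖ → ‖z‖ < R₂ → ∀ v : E3, v ≠ 0 → 0 < G c z v v) →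
        (∀ z : E3, R₁ < ‖z‖ → ‖z‖ < R₂ →
          MetricCoord.hamAt (G 0) (K 0) z = 0 ∧
            ∀ Z : E3, MetricCoord.momFn b₀ (G 0) (K 0) z Z = 0) →
        (∀ c, ∀ z : E3, R₁ < ‖z‖ → ‖z‖ < R₂ → (‖z‖ < a' ∨ b' < ‖z‖) →
          MetricCoord.hamAt (G c) (K c) z = 0 ∧
            ∀ Z : E3, MetricCoord.momFn b₀ (G c) (K c) z Z = 0) →
        (∀ (N : E3 → ℝ) (Y : E3 → E3),
          ContDiffOn ℝ ∞ N {z : E3 | a < ‖z‖ ∧ ‖z‖ < b} →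
          ContDiffOn ℝ ∞ Y {z : E3 | a < ‖z‖ ∧ ‖z‖ < b} →
          (∀ z : E3, a < ‖z‖ → ‖z‖ < b →
            MetricCoord.adjHamG (G 0) (K 0) N z + MetricCoord.adjMomGS (G 0) (K 0) Y z = 0 ∧
            MetricCoord.adjHamK (G 0) (K 0) N z + MetricCoord.adjMomKS (G 0) Y z = 0) →
          ∀ z : E3, a < ‖z‖ → ‖z‖ < b → N z = 0 ∧ Y z = 0) →
        ∃ (r : ℝ) (G' K' : EuclideanSpace ℝ (Fin 1) → E3 → E3 →L[ℝ] E3 →L[ℝ] ℝ), 0 < r ∧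
          ContDiffOn ℝ ∞ (fun p : EuclideanSpace ℝ (Fin 1) × E3 ↦ G' p.1 p.2)
            (ball (0 : EuclideanSpace ℝ (Fin 1)) r ×ˢ {z : E3 | R₁ < ‖z‖ ∧ ‖z‖ < R₂}) ∧
          ContDiffOn ℝ ∞ (fun p : EuclideanSpace ℝ (Fin 1) × E3 ↦ K' p.1 p.2)
            (ball (0 : EuclideanSpace ℝ (Fin 1)) r ×ˢ {z : E3 | R₁ < ‖z‖ ∧ ‖z‖ < R₂}) ∧
          (∀ c ∈ ball (0 : EuclideanSpace ℝ (Fin 1)) r, ∀ z : E3, R₁ < ‖z‖ → ‖z‖ < R₂ →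
            ∀ v w : E3, G' c z v w = G' c z w v ∧ K' c z v w = K' c z w v) ∧
          (∀ c ∈ ball (0 : EuclideanSpace ℝ (Fin 1)) r, ∀ z : E3, R₁ < ‖z‖ → ‖z‖ < R₂ →
            ∀ v : E3, v ≠ 0 → 0 < G' c z v v) ∧
          (∀ c ∈ ball (0 : EuclideanSpace ℝ (Fin 1)) r, ∀ z : E3, R₁ < ‖z‖ → ‖z‖ < R₂ →
            MetricCoord.hamAt (G' c) (K' c) z = 0 ∧
              ∀ Z : E3, MetricCoord.momFn b₀ (G' c) (K' c) z Z = 0) ∧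
          (∀ z : E3, R₁ < ‖z‖ → ‖z‖ < R₂ → G' 0 z = G 0 z ∧ K' 0 z = K 0 z) ∧
          (∀ c ∈ ball (0 : EuclideanSpace ℝ (Fin 1)) r, ∀ z : E3, R₁ < ‖z‖ → ‖z‖ < R₂ →
            (‖z‖ < a ∨ b < ‖z‖) → G' c z = G c z ∧ K' c z = K c z)) :
    ChruscielDelay_parametricAnnulusGluing :=
  ChruscielDelay_parametricAnnulusGluing_of_kidExhaustion_of_compactCore b₀ (kidExhaustion b₀) hE

end Literature.Geometry.Lorentzian

end
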